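import Summits.BirchSwinnertonDyer.Rank1Residual.X11b.KolyvaginH44OfTraceRelation
import HarnessLib

/-!
# Local inertia away from `m` fixes `P_m` (McCallum 1991, Lemma 4.3) — the END binder `hI` SUPPLIED
# from the Galois dictionary

Cell `b2b-bsdres`, team x11b3 (N8/O2), `h44` programme (lead GEN 9, (P4-B) of x11b3-p4 GEN 6).
Summit-side THEOREM-ONLY file (no definition, no named fact, no `sorry`); `K : Type`; nothing is
`p`-specific (no `p` at all).

HONEST FRAMING (binding): **plumbing.**  The binder `hI` of the consumer END
`KolyvaginH44.h44_of_traceRelation_of_congruence_of_dvd` (x11b3-p2) — McCallum 1991, Lemma 4.3 /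
Gross 1991, Prop. 6.2 (1) at `v ∤ m`: *"The class … is unramified at `v`"*, in the tree's
point-level form *the local inertia group at every `v ∤ m` fixes `j_m P_m`* — is SUPPLIED here from
binders the END ALREADY carries: the Galois dictionary (`e_m : K[m] → K̄`, injective
`ρ_m : 𝒢_m → Aut(K[m])`, `hπρ : τ • e_m x = e_m (ρ_m (π_m τ) x)`) and the `π_m`-equivariance of
`j_m`.  Ingredients, all LANDED tree theorems: `K[m]/K` is unramified at `v ∤ m` (Cox §9.A; tree
`isUnramifiedIn_ringClassField`) so GLOBAL inertia at any `𝔓 ∣ v` fixes `e_m(K[m])` pointwise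
(x11b3-p2's `smul_algHom_ringClassField_eq_self_of_mem_inertia`); LOCAL inertia restricts into
global inertia (Neukirch II (9.6), formal half; tree `resGalOfEmb_mem_inertia_primeBelow`,
`primeBelow_mem_primesAbove`); and an element fixing `e_m(K[m])` fixes `j_m P_m`
(`hrat_of_galoisDictionary`).  Nothing else: `h44` / (γ) / `h37`-in-general are NOT discharged;
`hA` untouched; the class record / (t) / node are unchanged; nothing booked; no mark / label /
count moves.

## What is proved

* `KolyvaginH44.resGal_smul_algHom_ringClassField_eq_self` — for `m ≥ 1`, `v ∤ m`, a prime `𝔐` of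
  the local absolute integers above `𝓂_v`, `t` in its inertia group and any `K`-embedding
  `e : K[m] → K̄`: `res(t) • e x = e x` for all `x ∈ K[m]`.
* **`KolyvaginH44.smul_kolyvaginPoint_eq_of_mem_localInertia`** — the END binder **`hI`**, its text
  verbatim, for EVERY `m` (the clause is vacuous at `m = 0`), from the dictionary binders
  `e ρ hρ hπρ π j hj` of the END.

## References

* [McCallumLMS1991] W. G. McCallum, *Kolyvagin's work on Shafarevich–Tate groups*, LMS LNS 153
  (1991), Lemma 4.3 (held `book:editornd-l-functions-arithmetic`, chunk 282 L3).
* [GrossLMS1991] B. H. Gross, *Kolyvagin's work on modular elliptic curves*, same volume,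
  Prop. 6.2 (1), §4 (4.1).
* [Cox2013] D. A. Cox, *Primes of the form x² + ny²*, 2nd ed., §9.A (p. 181).
* [NeukirchANT1999] J. Neukirch, *Algebraic Number Theory*, Ch. II §9 Prop. (9.6).

## Mathlib / tree search

Tree: `KolyvaginH44.hrat_of_galoisDictionary`, `KolyvaginH44.smul_algHom_ringClassField_eq_self_of_mem_inertia`
(`X11b/KolyvaginRingClassInertia`); `IsDedekindDomain.HeightOneSpectrum.{localPrimesAbove,
primeBelow, primeBelow_mem_primesAbove, resGalOfEmb_mem_inertia_primeBelow}`
(`SelmerInertia`, `NeronOggShafarevichLocal`); `resGal`, `resGal_eq`, `closureEmb` (`Sha`).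
`lean search 'KolyvaginPointInertia|smul_kolyvaginPoint_eq_of_mem_localInertia|resGal_smul_algHom'`
→ no matches (INTENT-grep).
-/

noncomputable section

open scoped Classical
open WeierstrassCurve Field NumberField IsDedekindDomain Finset
open Literature.NumberTheory.EllipticCurves Literature.NumberTheory.GaloisRepresentations
open Literature.NumberTheory.EllipticCurves.KolyvaginCocycle
open Literature.NumberTheory.EllipticCurves.KolyvaginEuler
open Literature.NumberTheory.EllipticCurves.RingClassField

namespace Summit.BirchSwinnertonDyer.Rank1Residual.X11b.KolyvaginH44

-- `K : Type`: the tree's ring-class class field theory is universe `0`.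
variable {K : Type} [Field K] [NumberField K]

/-- **Local inertia away from `m` fixes every embedded copy of `K[m]` pointwise.** For `K` imaginary
quadratic, `m ≥ 1`, a finite place `v ∤ m`, a prime `𝔐` of the local absolute integers `\bar 𝓞_v`
above `𝓂_v`, `t` in the inertia group of `𝔐` in `Γ_{K_v}`, and any `K`-embedding `e : K[m] → K̄`:
the restriction `res(t) ∈ Γ_K` fixes `e x` for every `x ∈ K[m]` — `res(t)` lies in the global inertia
group at `𝔓_{𝔐} ∣ v` (Neukirch II (9.6); tree `resGalOfEmb_mem_inertia_primeBelow`) and `K[m]/K` is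
unramified at `v ∤ m` (Cox §9.A; tree `smul_algHom_ringClassField_eq_self_of_mem_inertia`).
[cite: Cox2013, §9.A (p. 181)] [cite: NeukirchANT1999, Ch. II §9 (9.6)] -/
theorem resGal_smul_algHom_ringClassField_eq_self (hK : IsImaginaryQuadratic K) (ι : K →+* ℂ)
    {m : ℕ} (hm : m ≠ 0) (e : ringClassField K ι m →ₐ[K] AlgebraicClosure K)
    {v : HeightOneSpectrum (𝓞 K)} (hv : ((m : ℕ) : 𝓞 K) ∉ v.asIdeal)
    {𝔐 : Ideal (v.localAbsIntegers)} (h𝔐 : 𝔐 ∈ v.localPrimesAbove)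
    {t : absoluteGaloisGroup (v.adicCompletion K)}
    (ht : t ∈ 𝔐.inertia (absoluteGaloisGroup (v.adicCompletion K))) (x : ringClassField K ι m) :
    resGal (K := K) (v.adicCompletion K) t • e x = e x := by
  have hres : resGal (K := K) (v.adicCompletion K) t =
      resGalOfEmb (closureEmb (K := K) (v.adicCompletion K)) t := by
    rw [resGal_eq]
  rw [hres]
  exact smul_algHom_ringClassField_eq_self_of_mem_inertia hK ι hm e hv
    (v.primeBelow_mem_primesAbove (ι := closureEmb (K := K) (v.adicCompletion K)) h𝔐)
    (v.resGalOfEmb_mem_inertia_primeBelow (closureEmb (K := K) (v.adicCompletion K)) 𝔐 ht)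
    (SetLike.coe_mem x)

variable {N : ℕ} {W : WeierstrassCurve ℚ}

/-- **The END binder `hI` SUPPLIED from the Galois dictionary** (McCallum 1991, Lemma 4.3 at
`v ∤ m`; Gross 1991, Prop. 6.2 (1)): for every `m`, every finite place `v` with `m ∉ v`, every prime
`𝔐` of `\bar 𝓞_v` above `𝓂_v` and every `t` in its inertia group, `res(t)` fixes the embedded
Kolyvagin point `j_m P_m`, `P_m = Σ_{S} s · D_m y_m` (Gross (4.1)) — because `res(t)` fixes
`e_m(K[m])` pointwise (`resGal_smul_algHom_ringClassField_eq_self`) and therefore, through the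
dictionary `τ • e_m x = e_m (ρ_m (π_m τ) x)` with `ρ_m` injective and `j_m` `π_m`-equivariant, fixes
all of `j_m(A₀ m)` (`hrat_of_galoisDictionary`).  The statement is the binder `hI` of
`h44_of_traceRelation_of_congruence_of_dvd` verbatim (at `m = 0` its hypothesis `(0 : 𝓞 K) ∉ v` is
absurd).  HONEST: plumbing; `hI` SUPPLIED from binders the END already carries (`e ρ hρ hπρ π j hj`);
`h44` / (γ) / `h37`-in-general NOT discharged; `hA` untouched; nothing `p`-specific; nothing booked.
[cite: McCallumLMS1991, Lemma 4.3] [cite: GrossLMS1991, Prop. 6.2 (1), §4 (4.1)] -/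
theorem smul_kolyvaginPoint_eq_of_mem_localInertia (hK : IsImaginaryQuadratic K) (ι : K →+* ℂ)
    {𝒢 : ℕ → Type*} [∀ m, CommGroup (𝒢 m)] {A₀ : ℕ → Type*} [∀ m, AddCommGroup (A₀ m)]
    [∀ m, DistribMulAction (𝒢 m) (A₀ m)]
    (σ : ∀ m, ℕ → 𝒢 m) (L : ℕ → Finset ℕ) (H : ∀ m, Subgroup (𝒢 m))
    [∀ m, Fintype (𝒢 m ⧸ H m)] (f : ∀ m, 𝒢 m ⧸ H m → 𝒢 m) (y : ∀ m, A₀ m)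
    (π : ∀ m, absoluteGaloisGroup K →* 𝒢 m) (j : ∀ m, A₀ m →+ geomPoints (W.baseChange K))
    (hj : ∀ m (g : absoluteGaloisGroup K) (a : A₀ m), j m (π m g • a) = g • j m a)
    (e : ∀ m, ringClassField K ι m →ₐ[K] AlgebraicClosure K)
    (ρ : ∀ m, 𝒢 m →* (ringClassField K ι m ≃ₐ[ℚ] ringClassField K ι m))
    (hρ : ∀ m, Function.Injective (ρ m))
    (hπρ : ∀ m (τ : absoluteGaloisGroup K) (x : ringClassField K ι m),
      τ • e m x = e m (ρ m (π m τ) x)) :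
    ∀ m : ℕ, ∀ v : HeightOneSpectrum (𝓞 K), (m : 𝓞 K) ∉ v.asIdeal →
      ∀ 𝔐 ∈ v.localPrimesAbove, ∀ t ∈ 𝔐.inertia (absoluteGaloisGroup (v.adicCompletion K)),
        resGal (K := K) (v.adicCompletion K) t • j m (kolyvaginPoint (σ m) (L m) (f m) (y m)) =
          j m (kolyvaginPoint (σ m) (L m) (f m) (y m)) := by
  intro m v hv 𝔐 h𝔐 t ht
  have hm : m ≠ 0 := by
    rintro rfl
    exact hv (by rw [Nat.cast_zero]; exact v.asIdeal.zero_mem)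
  exact hrat_of_galoisDictionary ι σ L H f y π j hj e ρ hρ hπρ m hm _
    fun x => resGal_smul_algHom_ringClassField_eq_self hK ι hm (e m) hv h𝔐 ht x

end Summit.BirchSwinnertonDyer.Rank1Residual.X11b.KolyvaginH44

end
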